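import Mathlib
import Literature.Probability.RandomPlanarGeometry.HexSAW
import Summits.CriticalPhenomena.SAWScalingLimit.Theses.SAWMassiveIsingTilt
import Summits.CriticalPhenomena.SAWScalingLimit.Theorems.SAWMassiveIsingTiltDefs
import Summits.CriticalPhenomena.SAWScalingLimit.Theorems.SAWMassiveIsingTiltTiltLawBasic
import Summits.CriticalPhenomena.SAWScalingLimit.Theorems.SAWMassiveIsingTiltCriticalCurveContinuityScoreBoundSmallFugacity

/-!
# A-priori bound on the score covariance in the Kotecký–Preiss regime

Route `SAWMassiveIsingTilt` of `CriticalPhenomena/SAWScalingLimit`; line `registered` of the crux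
`CriticalCurveContinuity` (stmt-CriticalPhenomena-7686), cycle 4, sub-goal S4
`scoreCov_abs_le_smallFugacity`.

The `y`-score of the registered stub `stub_scoreDecoupling` is
`s_y(γ) = ℓ(γ)·xc'(y)/xc(y) + ∂_y log Zloop(Ω_δ∖γ; y)`. Writing `s_y = c₀ + g` with the
WALK-INDEPENDENT constant `c₀ = ∂_y log Zloop(Ω_δ; y)`, the covariance of any observable with `s_y`
under the tilted law `𝔓 = 𝔓^δ_{xc(y), y}` (a probability measure for joined endpoints, `xc(y) > 0`,
`y ≥ 0`) equals its covariance with `g`, and by the landed `zloop_score_sub_le_smallFugacity`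
(`|∂_y log Zloop(Ω_δ∖γ; y) − ∂_y log Zloop(Ω_δ; y)| ≤ K ℓ(γ)` for `y ∈ [0, y₁]`) we have
`|g(γ)| ≤ (|xc'(y)|/xc(y) + K)·ℓ(γ)`. Hence for every bounded continuous functional `f` of the curve,

`|Cov_𝔓(f ∘ curve, s_y)| ≤ 2‖f‖ · (|xc'(y)|/xc(y) + K) · 𝔼_𝔓[ℓ]`

(`scoreCov_abs_le_smallFugacity`), uniformly in the Dobrushin domain, the mesh and the endpoints:
the whole difficulty of score decoupling is localised in the growth of `𝔼^δ[ℓ]`. The abstract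
covariance inequality on a probability space is `abs_cov_sub_le_of_abs_sub_const_le`.
-/

noncomputable section

open MeasureTheory Finset Filter Topology Metric
open scoped NNReal ENNReal BoundedContinuousFunction
open Literature.Probability Literature.Probability.LatticeModels
  Literature.Probability.RandomPlanarGeometry
open Summit.CriticalPhenomena.SAWScalingLimit.Theses.SAWMassiveIsingTilt
open Summit.CriticalPhenomena.SAWScalingLimit.Theorems.ObservableToSLE.Negative (finite_hexDomainSAW)
open scoped Classical

namespace Summit.CriticalPhenomena.SAWScalingLimit.Theorems.SAWMassiveIsingTilt

/-! ### An abstract covariance inequality -/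

/-- **Covariance bound after removing a constant from the score.** On a probability space, if
`|F| ≤ A` pointwise and the "score" `s` differs from a constant `c₀` by at most `B·ℓ` pointwise,
then `|∫ F s − (∫ F)(∫ s)| ≤ 2 A B ∫ ℓ` (the constant drops out of the covariance, and
`|Cov(F, g)| ≤ |∫ F g| + |∫ F| |∫ g| ≤ 2 A ∫ |g|`). -/
theorem abs_cov_sub_le_of_abs_sub_const_le {α : Type*} [MeasurableSpace α] {μ : Measure α}
    [IsProbabilityMeasure μ] {F s ℓ : α → ℝ} {A B : ℝ} (c₀ : ℝ)
    (hF : Integrable F μ) (hs : Integrable s μ) (hℓ : Integrable ℓ μ)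
    (hFs : Integrable (fun x => F x * s x) μ)
    (hA : ∀ x, |F x| ≤ A) (hB : ∀ x, |s x - c₀| ≤ B * ℓ x) :
    |(∫ x, F x * s x ∂μ) - (∫ x, F x ∂μ) * ∫ x, s x ∂μ| ≤ 2 * A * B * ∫ x, ℓ x ∂μ := by
  -- the centred score `g = s - c₀`
  set g : α → ℝ := fun x => s x - c₀ with hg
  have hgi : Integrable g μ := hs.sub (integrable_const _)
  have hFgi : Integrable (fun x => F x * g x) μ := by
    have h : (fun x => F x * g x) = fun x => F x * s x - c₀ * F x := by
      funext x; simp only [hg]; ring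
    rw [h]
    exact hFs.sub (hF.const_mul _)
  -- the constant drops out of the covariance
  have e1 : ∫ x, F x * s x ∂μ = (∫ x, F x * g x ∂μ) + c₀ * ∫ x, F x ∂μ := by
    rw [← integral_const_mul, ← integral_add hFgi (hF.const_mul _)]
    refine integral_congr_ae (ae_of_all _ fun x => ?_)
    simp only [hg]; ring
  have e2 : ∫ x, s x ∂μ = (∫ x, g x ∂μ) + c₀ := by
    have h : ∫ x, g x ∂μ = (∫ x, s x ∂μ) - ∫ _x, c₀ ∂μ := integral_sub hs (integrable_const _)
    rw [h, integral_const, smul_eq_mul, probReal_univ, one_mul]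
    ring
  have hcov : (∫ x, F x * s x ∂μ) - (∫ x, F x ∂μ) * ∫ x, s x ∂μ =
      (∫ x, F x * g x ∂μ) - (∫ x, F x ∂μ) * ∫ x, g x ∂μ := by
    rw [e1, e2]; ring
  rw [hcov]
  -- the three elementary bounds
  have hIF : |∫ x, F x ∂μ| ≤ A := by
    calc |∫ x, F x ∂μ| ≤ ∫ x, |F x| ∂μ := abs_integral_le_integral_abs
      _ ≤ ∫ _x, A ∂μ := integral_mono hF.abs (integrable_const _) fun x => hA x
      _ = A := by rw [integral_const, smul_eq_mul, probReal_univ, one_mul]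
  have hA0 : 0 ≤ A := le_trans (abs_nonneg _) hIF
  have hIFg : |∫ x, F x * g x ∂μ| ≤ A * ∫ x, |g x| ∂μ := by
    calc |∫ x, F x * g x ∂μ| ≤ ∫ x, |F x * g x| ∂μ := abs_integral_le_integral_abs
      _ ≤ ∫ x, A * |g x| ∂μ := by
          refine integral_mono hFgi.abs (hgi.abs.const_mul _) fun x => ?_
          dsimp only
          rw [abs_mul]
          exact mul_le_mul_of_nonneg_right (hA x) (abs_nonneg _)
      _ = A * ∫ x, |g x| ∂μ := integral_const_mul _ _
  have hIg : |∫ x, g x ∂μ| ≤ ∫ x, |g x| ∂μ := abs_integral_le_integral_abs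
  have hgℓ : ∫ x, |g x| ∂μ ≤ B * ∫ x, ℓ x ∂μ := by
    calc ∫ x, |g x| ∂μ ≤ ∫ x, B * ℓ x ∂μ := integral_mono hgi.abs (hℓ.const_mul _) fun x => hB x
      _ = B * ∫ x, ℓ x ∂μ := integral_const_mul _ _
  -- assemble
  calc |(∫ x, F x * g x ∂μ) - (∫ x, F x ∂μ) * ∫ x, g x ∂μ|
      ≤ |∫ x, F x * g x ∂μ| + |(∫ x, F x ∂μ) * ∫ x, g x ∂μ| := abs_sub _ _
    _ ≤ A * ∫ x, |g x| ∂μ + A * ∫ x, |g x| ∂μ := by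
        refine add_le_add hIFg ?_
        rw [abs_mul]
        exact mul_le_mul hIF hIg (abs_nonneg _) hA0
    _ = 2 * A * ∫ x, |g x| ∂μ := by ring
    _ ≤ 2 * A * (B * ∫ x, ℓ x ∂μ) := mul_le_mul_of_nonneg_left hgℓ (by positivity)
    _ = 2 * A * B * ∫ x, ℓ x ∂μ := by ring

/-! ### The theorem -/

/-- **Sub-goal S4 of the line (cycle 4): a-priori bound on the score covariance in the
Kotecký–Preiss regime.** There are `y₁ > 0` and `K` such that for every curve `xc`, every
`y ∈ [0, y₁]` with `xc y > 0`, every Dobrushin domain, mesh `δ > 0`, joined endpoints `a`, `b` and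
bounded continuous functional `f` of the curve class, the covariance under the tilted law
`𝔓^δ_{xc y, y}` of `f ∘ curve` with the `y`-score
`s_y(γ) = ℓ(γ)·xc'(y)/xc(y) + ∂_y log Zloop(Ω_δ∖γ; y)` is at most
`2‖f‖ · (|xc'(y)|/xc(y) + K) · 𝔼^δ[ℓ]`. -/
theorem scoreCov_abs_le_smallFugacity : ∃ y₁ : ℝ, 0 < y₁ ∧ ∃ K : ℝ,
    ∀ (xc : ℝ → ℝ) (y : ℝ), y ∈ Set.Icc (0 : ℝ) y₁ → 0 < xc y →
      ∀ (D : DobrushinDomain) (δ : ℝ), 0 < δ → ∀ (a b : HexVertex),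
        (SAW.hexDomainGraph D.carrier δ).Reachable a b → ∀ f : CurveClass ℂ →ᵇ ℝ,
          |(∫ γ, f γ.curve * ((γ.vertexCount : ℝ) * deriv xc y / xc y +
                deriv (fun t => Zloop (SAW.hexDomainGraph D.carrier δ) {v | v ∉ γ.walk.support} t) y /
                  Zloop (SAW.hexDomainGraph D.carrier δ) {v | v ∉ γ.walk.support} y)
              ∂(tiltLaw D.carrier δ (xc y) y a b)) -
            (∫ γ, f γ.curve ∂(tiltLaw D.carrier δ (xc y) y a b)) *
              ∫ γ, ((γ.vertexCount : ℝ) * deriv xc y / xc y +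
                deriv (fun t => Zloop (SAW.hexDomainGraph D.carrier δ) {v | v ∉ γ.walk.support} t) y /
                  Zloop (SAW.hexDomainGraph D.carrier δ) {v | v ∉ γ.walk.support} y)
              ∂(tiltLaw D.carrier δ (xc y) y a b)| ≤
            2 * ‖f‖ * (|deriv xc y| / xc y + K) *
              ∫ γ, (γ.vertexCount : ℝ) ∂(tiltLaw D.carrier δ (xc y) y a b) := by
  obtain ⟨y₁, hy₁, K, hK⟩ := zloop_score_sub_le_smallFugacity
  refine ⟨y₁, hy₁, K, fun xc y hy hxcy D δ hδ a b hab f => ?_⟩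
  have hΩ : Bornology.IsBounded D.carrier := D.isBounded
  have hδ0 : δ ≠ 0 := ne_of_gt hδ
  haveI := finite_hexDomainSAW hΩ hδ0 a b
  haveI : MeasurableSingletonClass (SAW.HexDomainSAW D.carrier δ a b) :=
    measurableSingletonClass_hexDomainSAW
  haveI := isProbabilityMeasure_tiltLaw_of_reachable hΩ hδ0 hxcy hy.1 hab
  refine abs_cov_sub_le_of_abs_sub_const_le
    (deriv (fun t => Zloop (SAW.hexDomainGraph D.carrier δ) Set.univ t) y /
      Zloop (SAW.hexDomainGraph D.carrier δ) Set.univ y)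
    Integrable.of_finite Integrable.of_finite Integrable.of_finite Integrable.of_finite
    (fun γ => ?_) (fun γ => ?_)
  · -- `|f (curve γ)| ≤ ‖f‖`
    rw [← Real.norm_eq_abs]
    exact f.norm_coe_le_norm γ.curve
  · -- `|s_y(γ) - c₀| ≤ (|xc'|/xc + K) ℓ(γ)`
    have h := hK y hy D δ hδ a b γ
    have hℓ0 : (0 : ℝ) ≤ γ.vertexCount := Nat.cast_nonneg _
    rw [add_sub_assoc]
    refine (abs_add_le _ _).trans ?_
    rw [abs_div, abs_mul, abs_of_nonneg hℓ0, abs_of_pos hxcy, add_mul]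
    refine add_le_add (le_of_eq ?_) (by linarith [h])
    ring

end Summit.CriticalPhenomena.SAWScalingLimit.Theorems.SAWMassiveIsingTilt

end
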